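import Mathlib

/-!
# Border words: `E_02(x·y·z)` is a LIMIT of affine elementary words of length 5 (exact length 8)

Crux `ElementaryWordLength.WordPerSuperQuartic` (stmt-ValiantsHypothesis-6624), calibration of the chain / word model
(lead c4, idea `Cruxes/WordPerSuperQuartic/Ideas/principal-minor-pushforward.md`, question Q0).

Two polynomial identities in `SL₃` over any commutative ring, with free symbols `e`, `f`:

* `border_three_letter_word` :  `E₀₁(f·x) · E₁₂(e·y) · E₀₁(−f·x) = 1 + (e·f·x·y)·e₀₂ + (e·y)·e₁₂`;
* `border_five_letter_word`  :  `E₀₁(f·x) · E₁₀(y) · E₀₂(e·z) · E₁₀(−y) · E₀₁(−f·x) = 1 + (e·z + e·f·x·y·z)·e₀₂ + (e·y·z)·e₁₂`.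

Specialising `f·e = 1` (`f = ε⁻¹`, `e = ε`): the five-letter word equals `E₀₂(x·y·z) + ε·(z·e₀₂ + y·z·e₁₂)`
(`border_five_letter_word_of_mul_eq_one`), and the three-letter word equals `E₀₂(x·y) + ε·y·e₁₂`.  Hence the transvection
`E₀₂(x₀x₁x₂)` lies in the (Zariski and Euclidean) CLOSURE of the words of length 5 — read map `x z? …` = `x, y, z, y, x`, each
letter a genuine letter `E_ij(λ·x_v)` of the route's word model with `λ ∈ {±ε⁻¹, ±1, ε}` — although its EXACT word/chain
length is 8 (exhaustive search, kit j017569; arc lemma, `Cruxes/WordPerSuperQuartic/Ideator1Notes.md`).  So BORDER word length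
(5) < word length (8) already at degree 3: every lower-bound method that only uses EQUATIONS of the closure of short words/chains
(signature/flattening equations, the principal-minor push-forward equations) measures border length, which is strictly smaller.
References: Ben-Or–Cleve 1992 (the word model); Bringmann–Ikenmeyer–Zuiddam 2018 (border phenomena at small width).
-/

-- `Summit.ValiantsHypothesis.ValiantsHypothesis.…` is the tree's mandated single-conjunct layout.
set_option linter.dupNamespace false

namespace Summit.ValiantsHypothesis.ValiantsHypothesis.Theorems.WordPerSuperQuartic

/-- **Three-letter border word for `E₀₂(x·y)`**: `E₀₁(f·x)·E₁₂(e·y)·E₀₁(−f·x) = 1 + (e·f·x·y)·e₀₂ + (e·y)·e₁₂` over any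
commutative ring; with `f·e = 1`, `e = ε → 0` this tends to `E₀₂(x·y)`, whose exact word length is 4. [folklore] -/
theorem border_three_letter_word : ∀ {R : Type} [CommRing R] (x y e f : R),
    Matrix.transvection (0 : Fin 3) 1 (f * x) * Matrix.transvection (1 : Fin 3) 2 (e * y) *
        Matrix.transvection (0 : Fin 3) 1 (-(f * x)) =
      1 + Matrix.single (0 : Fin 3) (2 : Fin 3) (e * f * x * y) + Matrix.single (1 : Fin 3) (2 : Fin 3) (e * y) := by
  intro R _ x y e f
  ext i j
  fin_cases i <;> fin_cases j <;>
    (simp [Matrix.transvection, Matrix.mul_apply, Fin.sum_univ_three, Matrix.one_apply, Matrix.single]; try ring)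

/-- **Five-letter border word for `E₀₂(x·y·z)`**:
`E₀₁(f·x)·E₁₀(y)·E₀₂(e·z)·E₁₀(−y)·E₀₁(−f·x) = 1 + (e·z + e·f·x·y·z)·e₀₂ + (e·y·z)·e₁₂` over any commutative ring. [folklore] -/
theorem border_five_letter_word : ∀ {R : Type} [CommRing R] (x y z e f : R),
    Matrix.transvection (0 : Fin 3) 1 (f * x) * Matrix.transvection (1 : Fin 3) 0 y *
        Matrix.transvection (0 : Fin 3) 2 (e * z) * Matrix.transvection (1 : Fin 3) 0 (-y) *
        Matrix.transvection (0 : Fin 3) 1 (-(f * x)) =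
      1 + Matrix.single (0 : Fin 3) (2 : Fin 3) (e * z + e * f * x * y * z) +
        Matrix.single (1 : Fin 3) (2 : Fin 3) (e * y * z) := by
  intro R _ x y z e f
  ext i j
  fin_cases i <;> fin_cases j <;>
    (simp [Matrix.transvection, Matrix.mul_apply, Fin.sum_univ_three, Matrix.one_apply, Matrix.single]; try ring)

/-- **Border length of `E₀₂(x·y·z)` is at most 5.**  With `f·e = 1` (read `f = ε⁻¹`, `e = ε`) the five-letter word is
`E₀₂(x·y·z) + e • (z·e₀₂ + y·z·e₁₂)`, a word-valued polynomial curve through `E₀₂(x·y·z)` at `e = 0` — whereas the exact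
affine elementary word length of `E₀₂(x·y·z)` is 8. [folklore] -/
theorem border_five_letter_word_of_mul_eq_one : ∀ {R : Type} [CommRing R] (x y z e f : R), f * e = 1 →
    Matrix.transvection (0 : Fin 3) 1 (f * x) * Matrix.transvection (1 : Fin 3) 0 y *
        Matrix.transvection (0 : Fin 3) 2 (e * z) * Matrix.transvection (1 : Fin 3) 0 (-y) *
        Matrix.transvection (0 : Fin 3) 1 (-(f * x)) =
      Matrix.transvection (0 : Fin 3) 2 (x * y * z) +
        e • (Matrix.single (0 : Fin 3) (2 : Fin 3) z + Matrix.single (1 : Fin 3) (2 : Fin 3) (y * z)) := by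
  intro R _ x y z e f h
  have hxyz : e * z + e * f * x * y * z = x * y * z + e * z := by
    have h' : e * f = 1 := by rw [mul_comm]; exact h
    rw [h', one_mul, add_comm]
  rw [border_five_letter_word, hxyz]
  ext i j
  fin_cases i <;> fin_cases j <;>
    (simp [Matrix.transvection, Matrix.single]; try ring)

end Summit.ValiantsHypothesis.ValiantsHypothesis.Theorems.WordPerSuperQuartic
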